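import Literature.NumberTheory.Transcendental.Dolbeault
import Literature.NumberTheory.Transcendental.ComplexFormsProofs
import HarnessLib

/-!
# `∂̄` and `∂` of a form of pure type (Voisin 2002, Definition 2.27)

Trunk **T-KAEHLER** (`NumberTheory/Transcendental`). Theorems-only companion file of
`Literature/NumberTheory/Transcendental/Dolbeault.lean`, discharging its named facts

* `Literature.NumberTheory.Transcendental.IsOfType.dolbeaultBar_eq` by `Literature.NumberTheory.Transcendental.IsOfType.dolbeaultBar_eq_holds`: for a complex
  `k`-form `α` of pure type `(p,q)`, `∂̄α = (dα)^{p,q+1}`;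
* `Literature.NumberTheory.Transcendental.IsOfType.dolbeault_eq` by `Literature.NumberTheory.Transcendental.IsOfType.dolbeault_eq_holds`: for such `α`,
  `∂α = (dα)^{p+1,q}`;
* `Literature.NumberTheory.Transcendental.IsOfType.dolbeaultBar` by `Literature.NumberTheory.Transcendental.IsOfType.dolbeaultBar_holds`: `∂̄` raises the type by
  `(0,1)` (`∂̄α` has type `(p,q+1)`);
* `Literature.NumberTheory.Transcendental.IsOfType.dolbeault` by `Literature.NumberTheory.Transcendental.IsOfType.dolbeault_holds`: `∂` raises the type by `(1,0)`
  (`∂α` has type `(p+1,q)`);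
* `Literature.NumberTheory.Transcendental.dolbeaultBar_smul` by `Literature.NumberTheory.Transcendental.dolbeaultBar_smul_holds` and `Literature.NumberTheory.Transcendental.dolbeault_smul` by
  `Literature.NumberTheory.Transcendental.dolbeault_smul_holds`: `∂̄` and `∂` commute with complex scalars;

and recording the unconditional forms `Literature.NumberTheory.Transcendental.dolbeaultBar_conj'`, `Literature.NumberTheory.Transcendental.dolbeault_conj'` of the
theorems `Literature.NumberTheory.Transcendental.dolbeaultBar_conj`, `Literature.NumberTheory.Transcendental.dolbeault_conj` (whose named-fact hypotheses
`typeComponent_conj`, `mextDeriv_conj` are now discharged in `ComplexFormsProofs.lean`).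

## Source

C. Voisin, *Hodge Theory and Complex Algebraic Geometry I* (2002), §2.3.1, **Definition 2.27**
(p. 54): "For a `C¹` differential form `α` of type `(p,q)` on a complex manifold `X`, we define
`∂̄α` to be the component of type `(p,q+1)` of `dα`. Similarly, we define `∂α` to be the
component of type `(p+1,q)` of `dα`." and, for a general `k`-form with type components
`α^{p,q}`, "`∂̄α = ∑_{p,q} ∂̄α^{p,q}`, `∂α = ∑_{p,q} ∂α^{p,q}`". `Dolbeault.lean` takes the second
display as the definition of `Literature.NumberTheory.Transcendental.dolbeaultBar`/`Literature.NumberTheory.Transcendental.dolbeault` on all `k`-forms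
(`∂̄α = ∑_{p+q=k} (dα^{p,q})^{p,q+1}`); the two facts discharged here say that on forms of pure
type this agrees with the first display, i.e. with Definition 2.27 itself. (The docstrings of the
two facts in `Dolbeault.lean` point to "§2.3.3"; the printed locator is §2.3.1, Def. 2.27.) No
smoothness or atlas hypothesis is involved: the identities are algebraic in the type projections.

## Proof

Split the defining sum over the antidiagonal `p' + q' = k` at `(p', q') = (p, q)`: there
`α^{p,q} = α` (`Literature.NumberTheory.Transcendental.IsOfType.typeComponent_eq_self`), giving the summand `(dα)^{p,q+1}`; at every
other index `α^{p',q'} = 0` (`Literature.NumberTheory.Transcendental.IsOfType.typeComponent_of_ne_holds`), and `d0 = 0`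
(`Literature.Geometry.Kaehler.mextDeriv_zero`), `0^{p',q'+1} = 0`. Both ingredients are the directness of the type
decomposition, proved in `ComplexFormsProofs.lean`. This is the interim proof of the two facts,
now unconditional. The type-raising statements follow, since a type component `(dα)^{p',q'}`
has type `(p',q')` (`Literature.NumberTheory.Transcendental.isOfType_typeComponent_holds`, also from `ComplexFormsProofs.lean`).
`ℂ`-linearity of `∂̄`, `∂` is that of `d` (`Literature.NumberTheory.Transcendental.mextDeriv_smul_complex_holds`) and of the type
projections (`Literature.Geometry.Kaehler.MForm.typeComponent_smul`) — the interim proof, now unconditional.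

## References

* C. Voisin, *Hodge Theory and Complex Algebraic Geometry I*, Cambridge Studies in Advanced
  Mathematics 76, Cambridge University Press (2002), §2.3.1, Definition 2.27 (p. 54).
  [cite: Voisin2002]
* P. Griffiths, J. Harris, *Principles of Algebraic Geometry* (1978), p. 24 (`∂̄ = π^{p,q+1} ∘ d`
  on `A^{p,q}`).
-/

noncomputable section

open scoped Manifold ContDiff Topology
open Bundle Set Finset

namespace Literature.NumberTheory.Transcendental

variable {E : Type*} [NormedAddCommGroup E] [NormedSpace ℂ E]
  {M : Type*} [TopologicalSpace M] [ChartedSpace E M] {k : ℕ}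

/-- Discharge of `Literature.NumberTheory.Transcendental.IsOfType.dolbeaultBar_eq`: **for a form `α` of pure type `(p,q)`,
`∂̄α = (dα)^{p,q+1}`** — only the `(p,q)` summand of `∂̄α = ∑_{p'+q'=k} (dα^{p',q'})^{p',q'+1}`
survives, since `α^{p,q} = α` (`IsOfType.typeComponent_eq_self`) and `α^{p',q'} = 0` for
`(p',q') ≠ (p,q)` (`IsOfType.typeComponent_of_ne_holds`), with `d0 = 0` (`mextDeriv_zero`). This
is Voisin's definition of `∂̄` on forms of type `(p,q)`: Voisin (2002), §2.3.1, Definition 2.27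
(p. 54); Griffiths–Harris (1978), p. 24. [cite: Voisin2002, §2.3.1 Def. 2.27] -/
theorem IsOfType.dolbeaultBar_eq_holds :
    IsOfType.dolbeaultBar_eq (E := E) (M := M) (k := k) := by
  intro p q α hα
  have hmem : (p, q) ∈ antidiagonal k := by simpa using hα.1
  rw [Literature.NumberTheory.Transcendental.dolbeaultBar, ← Finset.sum_erase_add _ _ hmem, hα.typeComponent_eq_self,
    Finset.sum_eq_zero, zero_add]
  rintro ⟨p', q'⟩ hpq
  have hne : p ≠ p' ∨ q ≠ q' := by
    by_contra h
    push Not at h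
    exact (Finset.mem_erase.mp hpq).1 (by rw [h.1, h.2])
  simp [IsOfType.typeComponent_of_ne_holds hα hne, Literature.Geometry.Kaehler.mextDeriv_zero]

/-- Discharge of `Literature.NumberTheory.Transcendental.IsOfType.dolbeault_eq`: **for a form `α` of pure type `(p,q)`,
`∂α = (dα)^{p+1,q}`** — only the `(p,q)` summand of `∂α = ∑_{p'+q'=k} (dα^{p',q'})^{p'+1,q'}`
survives (`IsOfType.typeComponent_eq_self`, `IsOfType.typeComponent_of_ne_holds`,
`mextDeriv_zero`). This is Voisin's definition of `∂` on forms of type `(p,q)`: Voisin (2002),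
§2.3.1, Definition 2.27 (p. 54); Griffiths–Harris (1978), p. 24. [cite: Voisin2002, §2.3.1 Def. 2.27] -/
theorem IsOfType.dolbeault_eq_holds :
    IsOfType.dolbeault_eq (E := E) (M := M) (k := k) := by
  intro p q α hα
  have hmem : (p, q) ∈ antidiagonal k := by simpa using hα.1
  rw [Literature.NumberTheory.Transcendental.dolbeault, ← Finset.sum_erase_add _ _ hmem, hα.typeComponent_eq_self,
    Finset.sum_eq_zero, zero_add]
  rintro ⟨p', q'⟩ hpq
  have hne : p ≠ p' ∨ q ≠ q' := by
    by_contra h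
    push Not at h
    exact (Finset.mem_erase.mp hpq).1 (by rw [h.1, h.2])
  simp [IsOfType.typeComponent_of_ne_holds hα hne, Literature.Geometry.Kaehler.mextDeriv_zero]

/-- Discharge of `Literature.NumberTheory.Transcendental.IsOfType.dolbeaultBar`: **`∂̄` raises the type by `(0,1)`** — if `α` has
type `(p,q)` then `∂̄α = (dα)^{p,q+1}` (`IsOfType.dolbeaultBar_eq_holds`) has type `(p,q+1)`
(`isOfType_typeComponent_holds`). Voisin (2002), §2.3.1, Definition 2.27 (p. 54);
Huybrechts (2005), Lemma 1.3.6. [cite: Voisin2002, §2.3.1 Def. 2.27] -/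
theorem IsOfType.dolbeaultBar_holds :
    IsOfType.dolbeaultBar (E := E) (M := M) (k := k) := by
  intro p q α hα
  rw [IsOfType.dolbeaultBar_eq_holds hα]
  exact isOfType_typeComponent_holds (by have := hα.1; omega) _

/-- Discharge of `Literature.NumberTheory.Transcendental.IsOfType.dolbeault`: **`∂` raises the type by `(1,0)`** — if `α` has type
`(p,q)` then `∂α = (dα)^{p+1,q}` (`IsOfType.dolbeault_eq_holds`) has type `(p+1,q)`
(`isOfType_typeComponent_holds`). Voisin (2002), §2.3.1, Definition 2.27 (p. 54);
Huybrechts (2005), Lemma 1.3.6. [cite: Voisin2002, §2.3.1 Def. 2.27] -/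
theorem IsOfType.dolbeault_holds :
    IsOfType.dolbeault (E := E) (M := M) (k := k) := by
  intro p q α hα
  rw [IsOfType.dolbeault_eq_holds hα]
  exact isOfType_typeComponent_holds (by have := hα.1; omega) _

/-- Discharge of `Literature.NumberTheory.Transcendental.dolbeaultBar_smul`: **`∂̄` is `ℂ`-linear in the scalar**, `∂̄(cα) = c ∂̄α`
(no smoothness needed), from the `ℂ`-linearity of the type projections
(`MForm.typeComponent_smul`) and of `d` (`mextDeriv_smul_complex_holds`); immediate from the
definition of `∂̄` as a type component of `d`, Voisin (2002), §2.3.1, Definition 2.27 (p. 54). [cite: Voisin2002, §2.3.1 Def. 2.27] -/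
theorem dolbeaultBar_smul_holds : dolbeaultBar_smul (E := E) (M := M) (k := k) := by
  intro c α
  simp only [dolbeaultBar, Finset.smul_sum, Literature.Geometry.Kaehler.MForm.typeComponent_smul,
    mextDeriv_smul_complex_holds c]

/-- Discharge of `Literature.NumberTheory.Transcendental.dolbeault_smul`: **`∂` is `ℂ`-linear in the scalar**, `∂(cα) = c ∂α`
(`MForm.typeComponent_smul`, `mextDeriv_smul_complex_holds`); immediate from the definition of
`∂` as a type component of `d`, Voisin (2002), §2.3.1, Definition 2.27 (p. 54). [cite: Voisin2002, §2.3.1 Def. 2.27] -/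
theorem dolbeault_smul_holds : dolbeault_smul (E := E) (M := M) (k := k) := by
  intro c α
  simp only [dolbeault, Finset.smul_sum, Literature.Geometry.Kaehler.MForm.typeComponent_smul,
    mextDeriv_smul_complex_holds c]

/-- **`∂̄ ᾱ = \overline{∂α}`**, unconditionally: `dolbeaultBar_conj` fed with the discharged facts
`typeComponent_conj_holds` and `mextDeriv_conj_holds`. Voisin (2002), §2.3.1, proof of
Lemma 2.28 (p. 54: `∂α = \overline{∂̄ ᾱ}`). [cite: Voisin2002, §2.3.1, proof of Lemma 2.28] -/
theorem dolbeaultBar_conj' (α : Literature.Geometry.Kaehler.MForm 𝓘(ℝ, E) M ℂ k) :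
    dolbeaultBar α.conj = (dolbeault α).conj :=
  dolbeaultBar_conj (fun {_} ↦ typeComponent_conj_holds) mextDeriv_conj_holds α

/-- **`∂ ᾱ = \overline{∂̄α}`**, unconditionally (`dolbeault_conj` fed with
`typeComponent_conj_holds` and `mextDeriv_conj_holds`). Voisin (2002), §2.3.1, proof of
Lemma 2.28 (p. 54). [cite: Voisin2002, §2.3.1, proof of Lemma 2.28] -/
theorem dolbeault_conj' (α : Literature.Geometry.Kaehler.MForm 𝓘(ℝ, E) M ℂ k) :
    dolbeault α.conj = (dolbeaultBar α).conj :=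
  dolbeault_conj (fun {_} ↦ typeComponent_conj_holds) mextDeriv_conj_holds α

end Literature.NumberTheory.Transcendental
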